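/- Copyright: the b2b-balaban cell (near-miss cell 7), T⁴-continuum fan-out; row NE7b CRUX team (2), OWNER seat
t4-ne7b-p1 (gen 54) — INTERFACE REQUEST NE7b IR-54-1 «(α)-JOINT», item (J3b) part 2: the record over the no-region
reading with level-dependent sizes, for any datum.  Released under the licence of the surrounding project. -/
import Summits.QuantumFields.BalabanUV.T4Continuum.Support.HistoryRealiseCellsRunAssemblyWTVSJointReading

/-!
# (α)-JOINT, part 3b: THE LATTICE-UNIT RECORD `HistReadDataLWL` ON THE NO-REGION READING WITH LEVEL-DEPENDENT SIZES, FOR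
ANY DATUM, FROM THE DISPLAYED INPUTS (INTERFACE REQUEST NE7b IR-54-1 (J3b) part 2; owner lineage `t4-ne7b-p1` gen 54)

Summits-side support leaf of the T⁴-continuum cell (rung (B)+1 on a FINITE torus only; NOT infinite volume, NOT the
mass gap, NOT Clay; NOT a proof of NE7b — the cell's OWN estimate, NOT PRINTED, NOT PROVED).  [folklore] over part 3a
(`ℛ₅`, `Φ₆`) and leaf-05's parts 1–16 (`Isk`, `toyR`, `μ₀`, `trunc₃`, `ZD`, `histReadDataLWL₄`'s field list), REUSED BY
NAME; ONE record constructor (`histReadDataLWL₅`); nothing printed asserted, no `def … : Prop` fact, no cite-tagged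
hypothesis, zero `sorry`.

WHAT.  **`histReadDataLWL₅ (D) …`** = leaf-05's `histReadDataLWL₄` FIELD FOR FIELD over `ℛ₅ F.L R` ∕ `Φ₆`, with the
FLOW ROWS `isRj` (2.5), `h27` (2.7) at free letters `(β′, b₀, p27)`, `h29` (2.9), `hprof`, `hdrop`, the size floor
`2 ≤ R K t` and the lattice pin `1 ≤ lamVolL` as DISPLAYED INPUTS (part 3a's `flowRows_of_tuned` discharges them from
`BetaPertHyp` along tuned runs; part 4 does so on the joint datum), and otherwise EXACTLY `histReadDataLWL₄`'s inputs:
measurable averagings, the K-uniform envelope of the generating function, the (γ) floors and site budgets, the NE7c ∕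
NE7 sockets, the census letters under the identities and gaps, the sign letters.

HONEST.  Bookkeeping over OUR carriers at a no-region reading (every H3-side field VACUOUS BY DESIGN); the record's
R∕S fields stay HYPOTHESES of the assembly for real data.  Nothing of Bałaban's is discharged; every R-class row of the
wall stays; NE7b NOT PRINTED ∕ NOT PROVED; spine 0∕9.  HONEST DEPENDENCY (cell): continuum YM on T⁴ ⇐ BetaPertH ∧ nine
spine estimates (0/9 proved); BetaPertH ⇐ (D1) ∧ (D4) ∧ CAP+tail; G-an2-4 gates asym, D1 and NE2/3/4.  Unchanged here.
-/

open Finset MeasureTheory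
open Literature.MathematicalPhysics.QuantumFieldTheory.Balaban1983to89
open Literature.MathematicalPhysics.QuantumFieldTheory.Balaban1983to89.B16SProfile (DropCtl)
open T4PersistenceDictionary T4PersistentHistoryCount T4BankedInduction T4PrintedShapeBanking
open T4WeightBudget T4GlobalDenominator T4LiveClassFibration T4LiveStructureGas T4LiveGasToTerms T4RecordPriceSeam
open T4PartnerMultiplicity T4IndicatorShell T4MatchingAssembly T4MatchingClosure T4MatchingClosureSocket T4Continuum
open T4StabilitySocket T4BranchingRecordsGas T4TaggedShapeBanking T4CanonicalMenus T4RenewalChains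
open Summit.QuantumFields.BalabanUV.T4Continuum.HistoryFlow Summit.QuantumFields.BalabanUV.T4Continuum.HistoryGen
open Summit.QuantumFields.BalabanUV.T4Continuum.HistoryAdmissible
open Summit.QuantumFields.BalabanUV.T4Continuum.HistoryGenealogyExtraction
open Summit.QuantumFields.BalabanUV.T4Continuum.HistoryGenealogyRealise
open Summit.QuantumFields.BalabanUV.T4Continuum.HistoryGenealogyInstantiate
open Summit.QuantumFields.BalabanUV.T4Continuum.HistoryGenealogyPedigree
open Summit.QuantumFields.BalabanUV.T4Continuum.HistoryAssemblyPedigree Summit.QuantumFields.BalabanUV.T4Continuum.HistoryAssemblyTerms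
open Summit.QuantumFields.BalabanUV.T4Continuum.HistoryAssemblyMult Summit.QuantumFields.BalabanUV.T4Continuum.HistoryAssemblyMultKey
open Summit.QuantumFields.BalabanUV.T4Continuum.HistoryAssemblyRealiseRun Summit.QuantumFields.BalabanUV.T4Continuum.HistorySocketTH
open Summit.QuantumFields.BalabanUV.T4Continuum.HistoryRealiseDistinct
open Summit.QuantumFields.BalabanUV.T4Continuum.HistoryRealiseCellsRunApexT3bWTVS
open Summit.QuantumFields.BalabanUV.T4Continuum.B16HistoryIndexedRepr
open Summit.QuantumFields.BalabanUV.T4Continuum.B16HistoryIndexedTrunc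
open Summit.QuantumFields.BalabanUV.T4Continuum.HistoryBankingLE Summit.QuantumFields.BalabanUV.T4Continuum.HistoryBankingVolumePlug
open Summit.QuantumFields.BalabanUV.T4Continuum.HistoryConstants Summit.QuantumFields.BalabanUV.T4Continuum.HistoryBankingDiscountCharge
open Summit.QuantumFields.BalabanUV.T4Continuum.HistoryBankingCreditRead Summit.QuantumFields.BalabanUV.T4Continuum.HistoryBankingFibreRoom
open Summit.QuantumFields.BalabanUV.T4Continuum.HistoryPriceNodeSum Summit.QuantumFields.BalabanUV.T4Continuum.HistoryPriceKeys
open Summit.QuantumFields.BalabanUV.T4Continuum.HistoryRealiseCellsRunSupplyWTVS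
open Summit.QuantumFields.BalabanUV.T4Continuum.HistoryRealiseCellsRunSupplyKeysWTVS
open Summit.QuantumFields.BalabanUV.T4Continuum.HistoryRealiseCellsRunSupplyWTVSSanity
open Summit.QuantumFields.BalabanUV.T4Continuum.HistoryRealiseCellsRunSupplyKeysWTVSSanity
open Summit.QuantumFields.BalabanUV.T4Continuum.HistoryRealiseCellsRunAssemblyWTVSData
open Summit.QuantumFields.BalabanUV.T4Continuum.HistoryRealiseCellsRunAssemblyWTVS
open Summit.QuantumFields.BalabanUV.T4Continuum.HistoryRealiseCellsRunAssemblyWTVSDataL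
open Summit.QuantumFields.BalabanUV.T4Continuum.HistoryRealiseCellsRunAssemblyWTVSDataLW
open Summit.QuantumFields.BalabanUV.T4Continuum.HistoryRealiseCellsRunAssemblyWTVSDataLWL
open Summit.QuantumFields.BalabanUV.T4Continuum.HistoryRealiseCellsRunAssemblyWTVSSanity
open Summit.QuantumFields.BalabanUV.T4Continuum.HistoryRealiseCellsRun (runProfile_succ_le)
open Summit.QuantumFields.BalabanUV.T4Continuum.HistoryBankingSharpShares (ell sBsharp)
open Summit.QuantumFields.BalabanUV.T4Continuum.HistoryBankingRoundingUnrounded (sRunr ApFlat)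
open Summit.QuantumFields.BalabanUV.T4Continuum.HistoryBankingVolumeWindowLattice (uvolL uvolL_nonneg uvolL_eq_mul_uvol)

open Summit.QuantumFields.BalabanUV.T4Continuum.HistoryRealiseCellsRunAssemblyWTVSJointReading

namespace Summit.QuantumFields.BalabanUV.T4Continuum.HistoryRealiseCellsRunAssemblyWTVSJointRecord

noncomputable section

-- the structural `DecidableEq` instance of the concrete tag type exceeds the default synthesis size (as in the siblings)
set_option synthInstance.maxSize 1024

open B16HistoryIndexedRepr.Sanity B16HistoryIndexedRepr.SanityInput HistoryConstants.Sanity HistoryBankingCreditRead.Sanity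

/-! ## §3 The lattice-unit record on `ℛ₅ F.L R`, for any datum, from the displayed inputs -/

section Record

variable {F : T4Family} {G : Type*} [GaugeGroup G] [MeasurableSpace G] [HaarData G] [RegularGaugeGroup G]

/-- **`HistReadDataLWL` ON THE NO-REGION READING WITH LEVEL-DEPENDENT SIZES `R`** — leaf-05's `histReadDataLWL₄` FIELD
FOR FIELD over `ℛ₅ F.L R` ∕ `Φ₆`, with the FLOW ROWS `isRj` (2.5), `h27` (2.7) at `(β′, b₀, p27)`, `h29` (2.9), `hprof`,
`hdrop`, the size floor `2 ≤ R K t` and the lattice pin `1 ≤ lamVolL` as DISPLAYED INPUTS (part 4 discharges them on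
the joint datum from `BetaPertHyp` along tuned runs, §4), and otherwise EXACTLY `histReadDataLWL₄`'s inputs: measurable
averagings, the K-uniform envelope of the generating function, the (γ) floors and site budgets, the NE7c ∕ NE7
sockets, the census letters under the identities and gaps, the sign letters. [folklore] -/
def histReadDataLWL₅ (D : FiniteEpsData F G) (hM : D.AvgMeasurable) {C : T4PrintedShapeBanking.Consts} {O : PrintedO1s}
    (hn₁ : 13 ≤ C.n₁) (hE₂ : 0 < C.E₂) (hE₃ : 0 < C.E₃) (hp₀ : 1 ≤ C.p₀) (hA₀ : 0 < C.A₀) (hγ₀ : 0 < O.γ₀)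
    (hA₁ : O.A₁ ≠ 0) (hMO : 0 < O.M) (hβd : O.β₀ * ((O.d : ℝ) + 2) ≤ 1) {θv : ℝ} (hθv : 0 < θv) (rr n : ℕ)
    (hn : 0 < n) (g₀ : ℕ → ℝ) (os : List (ULoop F)) (R : ℕ → ℕ → ℕ) (hR2 : ∀ K t, 2 ≤ R K t) {cΛ M Lr Φ β₀ : ℝ}
    (hcΛ : 0 ≤ cΛ) (hMΛ : 0 ≤ M) (hLr : 0 ≤ Lr) (hΦ : 0 ≤ Φ) (hβ₀ : 0 ≤ β₀) (β' : ℝ) {p27 : ℕ} (hp27 : 1 ≤ p27)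
    {p₁ η η' κ κ₂ κᵥ : ℕ} (hexpR : C.p₀ + rr * (O.d + 3) + η = 2 * p₁)
    (hexpR' : rr * (C.q' + 1) + rr * (O.d + 3) + η' = 2 * p₁) (hexpB : rr * (C.q' + 1) + κ = 2 * C.p₀)
    (hexpFL : 1 + κ₂ = rr * (C.q' - 1)) (hdq : 1 ≤ C.q') (hexpVL : 1 + rr * 1 + κᵥ = 2 * C.p₀) (hη : 1 ≤ η)
    (hη' : 1 ≤ η') (hκ : 1 ≤ κ) (hκ₂ : 1 ≤ κ₂) (hκᵥ : 1 ≤ κᵥ) {Zi : ℝ} (hZ : ∀ K t, |t| ≤ 1 → ZD D g₀ os K t ≤ Zi)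
    (isRj : ∀ K s, s ≤ K → B14.IsRj F.L rr ((D.C ⟨K, F.m, g₀ K⟩).flow.g s) (R K s))
    (hΛ1 : ∀ K t, 1 ≤ lamVolL cΛ M 1 (D.C ⟨K, F.m, g₀ K⟩).flow.g (R K) K t)
    (h27 : ∀ K, B14.FlowIneq27 (D.C ⟨K, F.m, g₀ K⟩).flow.g β' β₀ p27 K)
    (h29 : ∀ K, B14FlowStep.FlowIneq29 (R K) (D.C ⟨K, F.m, g₀ K⟩).flow.g F.L β' β₀ K)
    (hprof : ∀ K t, t < K → runProfile F.L R K (t + 1) ≤ runProfile F.L R K t)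
    (hdrop : ∀ K m, DropCtl (runProfile F.L R K) m)
    {c₀ n₁ : ℝ} (c₀_pos : 0 < c₀) (floor : ∀ K, c₀ ≤ smallFieldMass D K (g₀ K))
    (floor' : ∀ K, c₀ ≤ smallFieldMass D (K + 1) (g₀ (K + 1)))
    (sites : ∀ K, ((D.C ⟨K, F.m, g₀ K⟩).numSites K : ℝ) ≤ n₁)
    (sites' : ∀ K, ((D.C ⟨K + 1, F.m, g₀ (K + 1)⟩).numSites (K + 1) : ℝ) ≤ n₁)
    {shA shB : ℕ → ℝ → HIndex.Idx Isk → ℝ} {Wsh : ℕ → ℝ}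
    (shell : ShellWeightBound 1 (HIndex.termSet Isk)
      (fun _ t => Repr172R.weight μ₀ (fun K t => toyR (ZD D g₀ os K t)) t)
      (weightB μ₀ (fun K t => toyR (ZD D g₀ os K t)) trunc₃) shA shB Wsh)
    {Cc Rr CcRec RrRec : ℕ → ℝ → HIndex.Idx Isk → ℝ} {ν u s₂ q₀ r s : ℕ → ℝ}
    (budget : ReindexedBudget 1 1 (HIndex.termSet Isk)
      (fun K t τ => Repr172R.weight μ₀ (fun K t => toyR (ZD D g₀ os K t)) t τ - shA K t τ)
      (fun K t τ => weightB μ₀ (fun K t => toyR (ZD D g₀ os K t)) trunc₃ K t τ - shB K t τ)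
      (badOfClass (bstrOf Prod.fst (memA n F.L (ℛ₅ F.L R))) (HIndex.termSet Isk)
        (fun K _ => badClasses Prod.fst (memA n F.L (ℛ₅ F.L R)) jhalf (HIndex.termSet Isk) K))
      Cc Rr CcRec RrRec ν u s₂ q₀ r s)
    (sum_r : Summable r) (sum_u : Summable u) (sum_s : Summable s) (sum_s₂ : Summable s₂) :
    HistReadDataLWL D C O θv rr 1 n hn g₀ os cΛ M Lr Φ β₀ p₁ η η' κ κ₂ κᵥ Isk Isk (fun _ => Unit) μ₀
      (fun _ => GoodClass.top Unit) (fun _ => Unit) μ₀ (fun _ => GoodClass.top Unit) where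
  l₀ := 1
  vol := 1
  l₀_pos := one_pos
  vol_pos := one_pos
  K₀ := 0
  RA K t := toyR (ZD D g₀ os K t)
  ρA K t V := ∑ a : (Isk K).Adm, (toyR (ZD D g₀ os K t)).term a V
  holdsA _ _ _ := rfl
  intA _ _ _ _ _ := Integrable.of_finite
  H2A K t _ _ := by
    show ZD D g₀ os K t = ∫ x, ∑ a : (Isk K).Adm, (toyR (ZD D g₀ os K t)).term a x ∂(Measure.dirac ())
    rw [MeasureTheory.integral_dirac, sum_term_toyR (ZD_pos D hM g₀ os K t)]
  ℛ := ℛ₅ F.L R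
  hL := rfl
  hs := rfl
  Φf := Φ₆ O (O.A₁ ^ 2) C Lr p₁ R (fun K => (D.C ⟨K, F.m, g₀ K⟩).flow.g) (ZD D g₀ os)
    (fun K t => lamVolL cΛ M 1 (D.C ⟨K, F.m, g₀ K⟩).flow.g ((ℛ₅ F.L R).R K) K t) hΛ1
  hR := histRead_toy₆ O (O.A₁ ^ 2) C Lr p₁ R _ (ZD D g₀ os) _ hΛ1 F.L
  isRj := isRj
  one_le_R K _ t := le_trans one_le_two (hR2 K t)
  hL4 := HistoryRealiseCellsRunPinned.four_le_L F
  hprof K _ t ht := hprof K t ht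
  hdrop K _ m := hdrop K m
  hN K _ τ _ := newOK_run₅ F.L R K τ
  hRm K _ τ _ := rm_le_run₅ F.L hR2 K τ
  hRmS K _ τ _ := rmS_run₅ F.L hR2 K τ
  hRm2 K _ τ _ := rm2_run₅ F.L R K τ
  hD K _ τ _ := newDisjoint_run₅ F.L R K τ
  hreg K _ τ _ := regionsInBox_run₅ F.L R n K τ
  hn₁ := hn₁
  hE₂ := hE₂
  hE₃pos := hE₃
  sB K := sBsharp O (O.A₁ ^ 2) C (D.C ⟨K, F.m, g₀ K⟩).flow.g
  φB _ _ _ := 0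
  φR _ _ := 0
  β' := β'
  hF K _ := factorRead_toy₆ O (O.A₁ ^ 2) C Lr p₁ R _ (ZD D g₀ os) _ hΛ1 F.L K
  h29 K _ := h29 K
  W _ := 2
  one_le_W _ := one_le_two
  Wi := 2
  BAi := Real.log (Zi / 6)
  mi := 1
  hWi _ := le_rfl
  hBA K _ ht _ := BA_le_of_le₆ O (O.A₁ ^ 2) C Lr p₁ R _ _ hΛ1 (fun K t _ => ZD_pos D hM g₀ os K t) hZ K ht
  hmi K := le_of_eq (by simp [μ₀])
  hρ K _ _ _ k hk := absurd hk (not_mem_badGMems₅ F.L R _ _ jhalf K k)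
  c₀ := c₀
  n₁ := n₁
  c₀_pos := c₀_pos
  floor K _ := floor K
  floor' K _ := floor' K
  sites K _ := sites K
  sites' K _ := sites' K
  RB K t := toyR (ZD D g₀ os K t)
  ρB K t V := ∑ a : (Isk (K + 1)).Adm, (toyR (ZD D g₀ os (K + 1) t)).term a V
  holdsB _ _ _ := rfl
  intB _ _ _ _ _ := Integrable.of_finite
  H2B K t _ _ := by
    show ZD D g₀ os (K + 1) t =
      ∫ x, ∑ a : (Isk (K + 1)).Adm, (toyR (ZD D g₀ os (K + 1) t)).term a x ∂(Measure.dirac ())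
    rw [MeasureTheory.integral_dirac, sum_term_toyR (ZD_pos D hM g₀ os (K + 1) t)]
  trunc := trunc₃
  htr K _ := trunc₃_mem K
  dB _ _ _ := 0
  mup _ _ := 0
  sB' K := sBsharp O (O.A₁ ^ 2) C (D.C ⟨K, F.m, g₀ K⟩).flow.g
  φB' _ _ _ := 0
  φR' _ _ := 0
  upB K _ _ _ k hk := absurd hk (not_mem_badGMems₅ F.L R _ _ jhalf K k)
  deadB_nonneg K _ _ _ k hk := absurd hk (not_mem_badGMems₅ F.L R _ _ jhalf K k)
  resumB K _ _ _ k hk := absurd hk (not_mem_badGMems₅ F.L R _ _ jhalf K k)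
  mup_bd _ _ _ _ := ⟨le_rfl, by positivity⟩
  shA := shA
  shB := shB
  Wsh := Wsh
  shell := shell
  Cc := Cc
  Rr := Rr
  CcRec := CcRec
  RrRec := RrRec
  ν := ν
  u := u
  s₂ := s₂
  q₀ := q₀
  r := r
  s := s
  budget := budget
  sum_r := sum_r
  sum_u := sum_u
  sum_s := sum_s
  sum_s₂ := sum_s₂
  hcΛ := hcΛ
  hMΛ := hMΛ
  hΛL K t := log_lamVolL cΛ M 1 _ _ K t
  hθv := hθv
  hβ₀ := hβ₀
  hLr := hLr
  hΦ := hΦ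
  m := O.A₁ ^ 2
  hm := le_rfl
  hexpR := hexpR
  hexpR' := hexpR'
  hexpB := hexpB
  hexpFL := hexpFL
  hdq := hdq
  hexpVL := hexpVL
  hη := hη
  hη' := hη'
  hκ := hκ
  hκ₂ := hκ₂
  hκᵥ := hκᵥ
  hp₀ := hp₀
  hAp := ApFlat_ne_zero hγ₀ hA₁ hMO hLr O.d
  hγ₀ := hγ₀
  hA₁ := hA₁
  hA₀ := hA₀
  hM := hMO
  hβd := hβd
  hφB K _ _ := mul_nonneg hΦ (dshare_nonneg hE₂.le hE₃.le _)
  hφR K _ := mul_nonneg hΦ (dshare_nonneg hE₂.le hE₃.le _)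
  hφB' K _ _ := mul_nonneg hΦ (dshare_nonneg hE₂.le hE₃.le _)
  hφR' K _ := mul_nonneg hΦ (dshare_nonneg hE₂.le hE₃.le _)
  hsB _ _ _ := le_rfl
  hsB' _ _ _ := le_rfl
  p27 := p27
  hp27 := hp27
  h27 K _ := h27 K

end Record

end

end Summit.QuantumFields.BalabanUV.T4Continuum.HistoryRealiseCellsRunAssemblyWTVSJointRecord
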